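import Summits.ResolutionOfSingularities.ResolutionOfSingularities.Theorems.FrobeniusLadderFInjectiveMacaulayficationBlowupFiModelOfCoverOpen
import HarnessLib

/-!
# E6‴ over a CLOSED set `V(𝔟)` of the base: the blow-up glue for a sub-cover of charts, restricted to the points over a closed subset
# (crux `FInjectiveMacaulayfication` stmt-ResolutionOfSingularities-15315, chain w45a; E7 scoping memo N2, `L/res-L1-w45a-lead-1/E7-SCOPING.md`)

[OURS · L1 W4.5a · res-L1-w45a-lead-1 gen 4] Support file (`--supports stmt-ResolutionOfSingularities-15315 --as helper`) for the
crux `FrobeniusLadder.FInjectiveMacaulayfication`; NOT a statement of any manuscript; AI-written, weaker than expert review.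

Twin of `BlowupFiModelOfCoverOpen.blowupClause_over_basicOpen` (p517174) with the OPEN `D(h)` replaced by a CLOSED `V(𝔟)` of the base — the shape a TOWER needs
(«every stalk of `Bl_I(Spec R)` over the fibre `V(𝔪_b R)` is good», hypothesis (GOOD) of 5h `PointFixableOfGoodTower.pointFixable_of_goodTower`): `hoff` is asked only at
the MAXIMAL ideals `Q ⊉ I` with `𝔟 ≤ Q` (the currency that chart certificates pay), `hon` only at exceptional maximal ideals of `R[I/vⱼ]` containing `𝔟·R[I/vⱼ]`, and the conclusion is
the full clause at every stalk of `affineBlowup I` at a point `y` with `𝔟 ≤ π(y)`. Proof = E6‴: a maximal ideal above the chart prime of such a point lies over `V(𝔟)` automatically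
(closedness goes the right way); the prime form of `hoff` comes from the maximal form by the Jacobson choice `BlowupFiModelOfCoverOpen.exists_isMaximal_le_notMem` (a maximal ideal
above `P ⊉ I` missing a chosen element of `I ∖ P`), whence the hypothesis `IsJacobsonRing R`. Decls: `chart_fiClause_of_maximal_overClosed`,
`chartClause_of_blowupAlgebraClause_overClosed`, `blowupClause_over_closed`.
-/

-- single-problem summit: the doubled namespace component is forced
set_option linter.dupNamespace false

noncomputable section

namespace Summit.ResolutionOfSingularities.ResolutionOfSingularities.Theorems.FInjectiveMacaulayfication.BlowupFiModelOfCoverOverClosed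

open AlgebraicGeometry CategoryTheory Literature.AlgebraicGeometry.Resolution
open Summit.ResolutionOfSingularities.ResolutionOfSingularities.Theorems.FInjectiveMacaulayfication

/-! ## §1 The chart clause at a prime over the closed set, closed-restricted hypotheses -/

/-- **The chart clause at every prime of `(R[It])_{(at)}` over `V(𝔟)`**, from: the clause of `R_P` at primes `P ∌ a` containing `𝔟` (off the
exceptional divisor, over `V(𝔟)`), and the chart clause at the maximal ideals containing `a/1` and `𝔟` (on the exceptional divisor, over `V(𝔟)`). Any maximal ideal
above the given prime is over `V(𝔟)`; then E6′'s case split (`BlowupFiModel.nonempty_ringEquiv_offExceptional`) and localisation to the smaller prime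
(`ClauseOfMaximal.fiClause_atPrime_of_le`). [folklore] -/
theorem chart_fiClause_of_maximal_overClosed (p : ℕ) [Fact p.Prime] {R : Type} [CommRing R] [IsDomain R] [IsNoetherianRing R]
    [CharP R p] {I : Ideal R} (a : R) (ha : a ∈ I) (ha0 : a ≠ 0) (𝔟 : Ideal R)
    (hoff : ∀ (P : Ideal R) [P.IsPrime], a ∉ P → 𝔟 ≤ P →
      IsDomain (Localization.AtPrime P) ∧
      ∀ d : ℕ, ringKrullDim (Localization.AtPrime P) = d → ∀ s : Fin d → Localization.AtPrime P,
        (Ideal.span (Set.range s)).radical.IsMaximal →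
          RingTheory.Sequence.IsWeaklyRegular (Localization.AtPrime P) (List.ofFn s) ∧
          ∀ y : Localization.AtPrime P, (∃ e : ℕ, y ^ p ^ e ∈ Ideal.span
            ((fun z : Localization.AtPrime P => z ^ p ^ e) ''
              (Ideal.span (Set.range s) : Set (Localization.AtPrime P)))) → y ∈ Ideal.span (Set.range s))
    (hon : ∀ (Q : Ideal (HomogeneousLocalization.Away (reesGrading I) (reesT a ha))) [Q.IsMaximal],
      reesChartBase (I := I) a ha a ∈ Q → 𝔟.map (reesChartBase (I := I) a ha) ≤ Q →
      ∀ d : ℕ, ringKrullDim (Localization.AtPrime Q) = d → ∀ s : Fin d → Localization.AtPrime Q,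
        (Ideal.span (Set.range s)).radical.IsMaximal →
          RingTheory.Sequence.IsWeaklyRegular (Localization.AtPrime Q) (List.ofFn s) ∧
          ∀ y : Localization.AtPrime Q, (∃ e : ℕ, y ^ p ^ e ∈ Ideal.span
            ((fun z : Localization.AtPrime Q => z ^ p ^ e) ''
              (Ideal.span (Set.range s) : Set (Localization.AtPrime Q)))) → y ∈ Ideal.span (Set.range s))
    (q : Ideal (HomogeneousLocalization.Away (reesGrading I) (reesT a ha))) [q.IsPrime]
    (hq : 𝔟.map (reesChartBase (I := I) a ha) ≤ q) :
    IsDomain (Localization.AtPrime q) ∧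
      ∀ d : ℕ, ringKrullDim (Localization.AtPrime q) = d → ∀ s : Fin d → Localization.AtPrime q,
        (Ideal.span (Set.range s)).radical.IsMaximal →
          RingTheory.Sequence.IsWeaklyRegular (Localization.AtPrime q) (List.ofFn s) ∧
          ∀ y : Localization.AtPrime q, (∃ e : ℕ, y ^ p ^ e ∈ Ideal.span
            ((fun z : Localization.AtPrime q => z ^ p ^ e) ''
              (Ideal.span (Set.range s) : Set (Localization.AtPrime q)))) → y ∈ Ideal.span (Set.range s) := by
  obtain ⟨hnoeth, hdom, hchar⟩ := ReesChartRing.stub_reesChartRing p R I a ha ha0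
  obtain ⟨Q, hQmax, hqQ⟩ := Ideal.exists_le_maximal q (Ideal.IsPrime.ne_top inferInstance)
  have hbQ : 𝔟.map (reesChartBase (I := I) a ha) ≤ Q := hq.trans hqQ
  refine ClauseOfMaximal.fiClause_atPrime_of_le p hqQ ?_
  by_cases huQ : reesChartBase (I := I) a ha a ∈ Q
  · exact ⟨inferInstance, hon Q huQ hbQ⟩
  · obtain ⟨e⟩ := BlowupFiModel.nonempty_ringEquiv_offExceptional a ha Q huQ
    have haP : a ∉ Ideal.comap (reesChartBase (I := I) a ha) Q := fun h' => huQ (Ideal.mem_comap.mp h')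
    have hbP : 𝔟 ≤ Ideal.comap (reesChartBase (I := I) a ha) Q := Ideal.map_le_iff_le_comap.mp hbQ
    obtain ⟨-, hP⟩ := hoff (Ideal.comap (reesChartBase (I := I) a ha) Q) haP hbP
    exact ⟨inferInstance, DegreeZeroDescent.inlineClause_of_ringEquiv p e.symm hP⟩

/-- Transport of the closed-restricted chart clause along `(R[It])_{(at)} ≅ R[I/a]` (`reesChartEquiv`): hypotheses on the image model
`R[I/a] = blowupAlgebra I a` (maximal ideals containing `a/1` and `𝔟·R[I/a]`) give the chart-ring form used by `chart_fiClause_of_maximal_overClosed`. [folklore] -/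
theorem chartClause_of_blowupAlgebraClause_overClosed (p : ℕ) {R : Type} [CommRing R] {I : Ideal R} (a : R) (ha : a ∈ I)
    (𝔟 : Ideal R)
    (hon : ∀ (Q : Ideal (blowupAlgebra I a)) [Q.IsMaximal], algebraMap R (blowupAlgebra I a) a ∈ Q →
      𝔟.map (algebraMap R (blowupAlgebra I a)) ≤ Q →
      ∀ d : ℕ, ringKrullDim (Localization.AtPrime Q) = d → ∀ s : Fin d → Localization.AtPrime Q,
        (Ideal.span (Set.range s)).radical.IsMaximal →
          RingTheory.Sequence.IsWeaklyRegular (Localization.AtPrime Q) (List.ofFn s) ∧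
          ∀ y : Localization.AtPrime Q, (∃ e : ℕ, y ^ p ^ e ∈ Ideal.span
            ((fun z : Localization.AtPrime Q => z ^ p ^ e) ''
              (Ideal.span (Set.range s) : Set (Localization.AtPrime Q)))) → y ∈ Ideal.span (Set.range s))
    (Q : Ideal (HomogeneousLocalization.Away (reesGrading I) (reesT a ha))) [Q.IsMaximal]
    (haQ : reesChartBase (I := I) a ha a ∈ Q) (hbQ : 𝔟.map (reesChartBase (I := I) a ha) ≤ Q) :
    ∀ d : ℕ, ringKrullDim (Localization.AtPrime Q) = d → ∀ s : Fin d → Localization.AtPrime Q,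
      (Ideal.span (Set.range s)).radical.IsMaximal →
        RingTheory.Sequence.IsWeaklyRegular (Localization.AtPrime Q) (List.ofFn s) ∧
        ∀ y : Localization.AtPrime Q, (∃ e : ℕ, y ^ p ^ e ∈ Ideal.span
          ((fun z : Localization.AtPrime Q => z ^ p ^ e) ''
            (Ideal.span (Set.range s) : Set (Localization.AtPrime Q)))) → y ∈ Ideal.span (Set.range s) := by
  have hmem : algebraMap R (blowupAlgebra I a) a ∈ Q.map (reesChartEquiv a ha) := by
    rw [← reesChartEquiv_reesChartBase a ha a, Ideal.apply_mem_of_equiv_iff]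
    exact haQ
  have hle : 𝔟.map (algebraMap R (blowupAlgebra I a)) ≤ Q.map (reesChartEquiv a ha) := by
    rw [← reesChartEquiv_comp_reesChartBase a ha, ← Ideal.map_map]
    exact Ideal.map_mono hbQ
  have hQ' := hon (Q.map (reesChartEquiv a ha)) hmem hle
  obtain ⟨eL⟩ := BlowupFiModelOfCover.nonempty_ringEquiv_localization_of_ringEquiv (reesChartEquiv a ha) Q
    (Q.map (reesChartEquiv a ha)) fun x => Ideal.apply_mem_of_equiv_iff
  exact DegreeZeroDescent.inlineClause_of_ringEquiv p eL.symm hQ'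

/-! ## §2 The closed-restricted glue -/

/-- **E6‴ OVER `V(𝔟)` — THE CLOSED-RESTRICTED BLOW-UP GLUE (tower shape).** `R` a Noetherian Jacobson domain of characteristic `p`, `v₁,…,v_t ∈ I`
non-zero with `R[It]₊ ⊆ √(v₁t,…,v_tt)`, `𝔟 ⊆ R` an ideal (in a tower: the ideal of the fibre over the point `b` downstairs). If `R_Q` satisfies the
Cohen–Macaulay + Frobenius-closed clause at every MAXIMAL `Q ⊉ I` containing `𝔟`, and every `R[I/vⱼ]` satisfies it at its maximal ideals containing `vⱼ/1`
and `𝔟·R[I/vⱼ]`, then EVERY STALK OF `Bl_I(Spec R) = affineBlowup I` AT A POINT OVER `V(𝔟)` is a domain satisfying the clause. [cite: StacksProject, Tag 0804] -/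
theorem blowupClause_over_closed (p : ℕ) [Fact p.Prime] (R : Type) [CommRing R] [IsDomain R] [IsNoetherianRing R]
    [IsJacobsonRing R] [CharP R p] (I : Ideal R) (t : ℕ) (v : Fin t → R) (hv : ∀ j : Fin t, v j ∈ I)
    (hv0 : ∀ j : Fin t, v j ≠ 0)
    (hcov : (HomogeneousIdeal.irrelevant (reesGrading I)).toIdeal ≤
      (Ideal.span (Set.range fun j : Fin t => reesT (I := I) (v j) (hv j))).radical)
    (𝔟 : Ideal R)
    (hoff : ∀ (Q : Ideal R) [Q.IsMaximal], ¬ I ≤ Q → 𝔟 ≤ Q →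
      ∀ d : ℕ, ringKrullDim (Localization.AtPrime Q) = d → ∀ s : Fin d → Localization.AtPrime Q,
        (Ideal.span (Set.range s)).radical.IsMaximal →
          RingTheory.Sequence.IsWeaklyRegular (Localization.AtPrime Q) (List.ofFn s) ∧
          ∀ y : Localization.AtPrime Q, (∃ e : ℕ, y ^ p ^ e ∈ Ideal.span
            ((fun z : Localization.AtPrime Q => z ^ p ^ e) ''
              (Ideal.span (Set.range s) : Set (Localization.AtPrime Q)))) → y ∈ Ideal.span (Set.range s))
    (hon : ∀ (j : Fin t) (Q : Ideal (Literature.AlgebraicGeometry.Resolution.blowupAlgebra I (v j))) [Q.IsMaximal],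
      algebraMap R (Literature.AlgebraicGeometry.Resolution.blowupAlgebra I (v j)) (v j) ∈ Q →
      𝔟.map (algebraMap R (Literature.AlgebraicGeometry.Resolution.blowupAlgebra I (v j))) ≤ Q →
      ∀ d : ℕ, ringKrullDim (Localization.AtPrime Q) = d → ∀ s : Fin d → Localization.AtPrime Q,
        (Ideal.span (Set.range s)).radical.IsMaximal →
          RingTheory.Sequence.IsWeaklyRegular (Localization.AtPrime Q) (List.ofFn s) ∧
          ∀ y : Localization.AtPrime Q, (∃ e : ℕ, y ^ p ^ e ∈ Ideal.span
            ((fun z : Localization.AtPrime Q => z ^ p ^ e) ''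
              (Ideal.span (Set.range s) : Set (Localization.AtPrime Q)))) → y ∈ Ideal.span (Set.range s))
    (y : ↥(affineBlowup I)) (hy : 𝔟 ≤ ((affineBlowup.π I).base y).asIdeal) :
    IsDomain ((affineBlowup I).presheaf.stalk y) ∧ ∀ d : ℕ, ringKrullDim ((affineBlowup I).presheaf.stalk y) = d →
      ∀ s : Fin d → (affineBlowup I).presheaf.stalk y, (Ideal.span (Set.range s)).radical.IsMaximal →
        RingTheory.Sequence.IsWeaklyRegular ((affineBlowup I).presheaf.stalk y) (List.ofFn s) ∧
        ∀ z : (affineBlowup I).presheaf.stalk y, (∃ e : ℕ, z ^ p ^ e ∈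
            Ideal.span ((fun w : (affineBlowup I).presheaf.stalk y => w ^ p ^ e) ''
              (Ideal.span (Set.range s) : Set ((affineBlowup I).presheaf.stalk y)))) →
          z ∈ Ideal.span (Set.range s) := by
  -- the point lies in some chart `D₊(vⱼt)`; write it as `awayι q`
  obtain ⟨j, hj⟩ := BlowupFiModelOfCover.exists_mem_basicOpen_of_irrelevant_le_radical v hv hcov y
  rw [← Proj.opensRange_awayι (reesGrading I) (reesT (v j) (hv j)) (reesT_mem (v j) (hv j)) Nat.one_pos] at hj
  obtain ⟨q, rfl⟩ := Scheme.Hom.mem_opensRange.mp hj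
  -- the stalk is the local ring of the chart ring at `q`
  have e : ((affineBlowup I).presheaf.stalk
      (Proj.awayι (reesGrading I) (reesT (v j) (hv j)) (reesT_mem (v j) (hv j)) Nat.one_pos q)) ≃+*
        Localization.AtPrime q.asIdeal :=
    ((asIso ((Proj.awayι (reesGrading I) (reesT (v j) (hv j)) (reesT_mem (v j) (hv j))
      Nat.one_pos).stalkMap q)).commRingCatIsoToRingEquiv).trans
      (Spec.stalkIso (.of (HomogeneousLocalization.Away (reesGrading I) (reesT (v j) (hv j)))) q
        ).commRingCatIsoToRingEquiv
  -- `q` lies over `V(𝔟)`: `𝔟 · chart ≤ q`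
  have hq : 𝔟.map (reesChartBase (I := I) (v j) (hv j)) ≤ q.asIdeal := by
    have h1 : 𝔟 ≤ (affineBlowup.π I (Proj.awayι (reesGrading I) (reesT (v j) (hv j)) (reesT_mem (v j) (hv j)) Nat.one_pos q)).asIdeal := hy
    rw [affineBlowup.π_awayι_reesT_apply] at h1
    exact Ideal.map_le_iff_le_comap.mpr h1
  -- the closed-restricted chart clause at `q`
  have hoff' : ∀ (P : Ideal R) [P.IsPrime], v j ∉ P → 𝔟 ≤ P →
      IsDomain (Localization.AtPrime P) ∧
      ∀ d : ℕ, ringKrullDim (Localization.AtPrime P) = d → ∀ s : Fin d → Localization.AtPrime P,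
        (Ideal.span (Set.range s)).radical.IsMaximal →
          RingTheory.Sequence.IsWeaklyRegular (Localization.AtPrime P) (List.ofFn s) ∧
          ∀ y : Localization.AtPrime P, (∃ e : ℕ, y ^ p ^ e ∈ Ideal.span
            ((fun z : Localization.AtPrime P => z ^ p ^ e) ''
              (Ideal.span (Set.range s) : Set (Localization.AtPrime P)))) → y ∈ Ideal.span (Set.range s) :=
    fun P _ hxP hbP => by
      -- Jacobson choice: a maximal ideal above `P`, over `V(𝔟)`, missing `v j`
      obtain ⟨Q, hQ, hPQ, hvQ⟩ := BlowupFiModelOfCoverOpen.exists_isMaximal_le_notMem P hxP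
      haveI := hQ
      exact ClauseOfMaximal.fiClause_atPrime_of_le p hPQ
        ⟨inferInstance, hoff Q (fun hle => hvQ (hle (hv j))) (hbP.trans hPQ)⟩
  obtain ⟨hdom, hcl⟩ := chart_fiClause_of_maximal_overClosed p (v j) (hv j) (hv0 j) 𝔟 hoff'
    (fun Q _ haQ hbQ => chartClause_of_blowupAlgebraClause_overClosed p (v j) (hv j) 𝔟 (hon j) Q haQ hbQ) q.asIdeal hq
  haveI := hdom
  exact ⟨MulEquiv.isDomain (Localization.AtPrime q.asIdeal) e.toMulEquiv,
    DegreeZeroDescent.inlineClause_of_ringEquiv p e.symm hcl⟩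

end Summit.ResolutionOfSingularities.ResolutionOfSingularities.Theorems.FInjectiveMacaulayfication.BlowupFiModelOfCoverOverClosed

end
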